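import Summits.ResolutionOfSingularities.ResolutionOfSingularities.Theorems.KRoot
import Summits.ResolutionOfSingularities.ResolutionOfSingularities.Theorems.KFrameRing
import HarnessLib

/-!
# «KFrames» — the frame induction of the tower dictionary: from a chain of certified point blow-ups to a `ForcedWalk`

(lens-5 g39, node g39n; critic ROW 232 Q2a / ROW 238 window, door (M-Dict); letters 238a f1–f7 / 238b–h.)

Layer C5 of `NEXT-g40.md` §6.11, GENERIC and scheme-free.  Fix `q = pᵉ` and a field `K` (perfect, char `p`).
A FRAME DATUM at a local subring `B̃ ⊆ L` for an element `f ∈ L` (`Frame σ K B̃ q f`) is an injective frame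
`θ : K[Z,u] → L` with `B(θ) = B̃`, variables in `𝔪_{B̃}`, a state `s` whose polynomial has all monomials of degree
`≥ q`, and a unit `v` of `B̃` with `θ (Z^q + s.F) = v·f`.

* §1 `Frame`, `maxSet_eq_of_eq`; **`exists_frame_succ`** — one certified point blow-up `B ⊆ B₁` (tree
  `ShallowPort.PointBlowupCert`) read inside local subrings `B ≤ B̃ ≤ B̃' ⊇ B₁` with `𝔪_B·B̃ = 𝔪_{B̃}` (`hM`),
  `𝔪_{B̃} ⊆ 𝔪_{B̃'}`, units of `B̃` units of `B̃'`, `K`-rational residues on `B̃'`, and a factorisation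
  `f = w·c_j^q·f'` (`w` unit, `f' ∈ 𝔪_{B̃'}^q`) carries a frame datum for `f` at `B̃` to a frame datum for `f'` at `B̃'`
  whose state is the tree's `step q j b s` with `b j = 0` and `IsEquimultiplePoint q j b s` — `KRoot.kframe_step` with the
  origin-ideal hypothesis discharged by `KFrameRing.mem_originIdeal_iff_mem_maxSet`.
* §2 **`nonempty_forcedWalk`** — the ℕ-recursion: a step relation as in §1 at every stage plus isolation of the top locus
  for every frame datum yield a `TightDefectClasses.ForcedWalk q Φ₀.s` from any stage-`0` datum `Φ₀`;
  **`nonempty_forcedWalk_of_chain`** — the same with the step relation discharged by §1 along ℕ-indexed chain data.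
* §3 **`exists_root_frame`** — the stage-`0` datum with a ROOT state (`KRoot.exists_root_frame`, `v = 1`).

Layer E instantiates `B i := ψ_i(𝒪_{X_i,x_i})`, `B̃ i := (B_i ⊗_k K)_{𝔴_i}` [Theorems/KStage], `f i := ψ_i f_i`, the certificates
`inextCert` and factorisations `inextStage_fact` [Theorems/StalkThread2], and discharges isolation by [Theorems/KGenerFrame, KGener].
(Sources: Hauser2010 §§F–G; CossartPiltant2019 §2; folklore.)
-/

open MvPolynomial
open Literature.AlgebraicGeometry.Resolution
open Literature.AlgebraicGeometry.Resolution.Hauser2010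
open Literature.AlgebraicGeometry.Resolution.PointBlowup
open Summit.ResolutionOfSingularities.ResolutionOfSingularities.Theorems.FrameStep
open Summit.ResolutionOfSingularities.ResolutionOfSingularities.Theorems.TightDefectClasses (IsRoot ForcedWalk IsolatedTop)
open Summit.ResolutionOfSingularities.ResolutionOfSingularities.Theorems.ShallowPort (PointBlowupCert)

set_option linter.dupNamespace false

namespace Summit.ResolutionOfSingularities.ResolutionOfSingularities.Theorems.KFrames

noncomputable section

variable {σ : Type} [Fintype σ] [DecidableEq σ] {K : Type} [Field K] {L : Type} [Field L] [Algebra K L]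

/-! ## §1 Frame data and the step -/

variable (σ K) in
/-- (Type-valued carrier.) **A frame datum** at the local subring `Bt ⊆ L` for the element `f`: an injective frame `θ` with
`B(θ) = Bt`, variables in `𝔪_{Bt}`, a state `s` with all monomials of `s.F` of degree `≥ q`, and a unit `v` of `Bt` with
`θ (Z^q + s.F) = v·f`. -/
structure Frame (Bt : Subring L) [IsLocalRing Bt] (q : ℕ) (f : L) : Type where
  /-- the frame -/
  θ : MvPolynomial (Option σ) K →ₐ[K] L
  /-- it is injective -/
  hθ : Function.Injective θ
  /-- its frame ring is `Bt` -/
  hB : frameRing θ hθ = Bt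
  /-- its variables lie in `𝔪_{Bt}` -/
  hvars : ∀ o, θ (X o) ∈ maxSet Bt
  /-- the state -/
  s : State σ K
  /-- all monomials of `s.F` have degree `≥ q` -/
  hs : ∀ d ∈ s.F.support, q ≤ d.degree
  /-- the unit -/
  v : L
  /-- it is a unit of `Bt` -/
  hv : v ∈ unitSet Bt
  /-- `θ (Z^q + s.F) = v·f` -/
  hfv : θ (framePoly q s.F) = v * f

omit [Fintype σ] [DecidableEq σ] [Field K] [Algebra K L] in
/-- `maxSet` does not depend on the local-ring witness: equal subrings have equal `maxSet`. -/
theorem maxSet_eq_of_eq {S S' : Subring L} [hS : IsLocalRing S] [hS' : IsLocalRing S'] (h : S = S') :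
    maxSet S = maxSet S' := by
  subst h
  rfl

/-- **The step of the frame induction.**  See the module docstring. -/
theorem exists_frame_succ (p : ℕ) [Fact p.Prime] [CharP K p] [PerfectField K] [DecidableEq K] (e : ℕ)
    {B Bt Bt' B₁ : Subring L} [IsLocalRing Bt] [IsLocalRing Bt'] (hB : B ≤ Bt) (hBt : Bt ≤ Bt') (hB₁ : B₁ ≤ Bt')
    {M : Ideal B} (cert : PointBlowupCert B B₁ M)
    (hgen : ∀ w ∈ Bt', ∃ x ∈ Subring.closure ((Bt : Set L) ∪ B₁), ∃ x' ∈ Subring.closure ((Bt : Set L) ∪ B₁),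
      x' ∈ unitSet Bt' ∧ w = x / x')
    (hM : ∀ x : L, x ∈ maxSet Bt ↔ ∃ hx : x ∈ Bt, (⟨x, hx⟩ : Bt) ∈ M.map (Subring.inclusion hB))
    (hmax : maxSet Bt ⊆ maxSet Bt') (hunit : unitSet Bt ⊆ unitSet Bt')
    (hrat : ∀ w ∈ Bt', ∃ c : K, w - algebraMap K L c ∈ maxSet Bt')
    {f f' w : L} (hw : w ∈ unitSet Bt') (hfact : f = w * (cert.c cert.j : L) ^ p ^ e * f')
    (hf'q : ∃ h : f' ∈ Bt', (⟨f', h⟩ : Bt') ∈ IsLocalRing.maximalIdeal Bt' ^ p ^ e)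
    (Φ : Frame σ K Bt (p ^ e) f) :
    ∃ (j : σ) (b : σ → K) (Φ' : Frame σ K Bt' (p ^ e) f'),
      Φ'.s = step (p ^ e) j b Φ.s ∧ b j = 0 ∧ IsEquimultiplePoint (p ^ e) j b Φ.s := by
  have hMθ : ∀ x : L, (∃ hx : x ∈ frameRing Φ.θ Φ.hθ, (⟨x, hx⟩ : frameRing Φ.θ Φ.hθ) ∈ originIdeal Φ.θ Φ.hθ) ↔
      (∃ hx : x ∈ Bt, (⟨x, hx⟩ : Bt) ∈ M.map (Subring.inclusion hB)) := by
    intro x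
    rw [KFrameRing.mem_originIdeal_iff_mem_maxSet Φ.θ Φ.hθ x,
      maxSet_eq_of_eq (hS := KFrameRing.isLocalRing_frameRing Φ.θ Φ.hθ) Φ.hB]
    exact hM x
  have hloc : ∀ o, Φ.θ (X o) ∈ maxSet Bt' := fun o => hmax (Φ.hvars o)
  obtain ⟨j, b, θ', hθ', hbj, hB', hvars', ⟨v', hv', hfv'⟩, hequi, hs'⟩ :=
    KRoot.kframe_step p e hB hBt hB₁ cert hgen Φ.θ Φ.hθ Φ.hB hMθ hloc hrat Φ.s Φ.hs (hunit Φ.hv) hw Φ.hfv hfact hf'q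
  exact ⟨j, b, ⟨θ', hθ', hB', hvars', step (p ^ e) j b Φ.s, hs', v', hv', hfv'⟩, rfl, hbj, hequi⟩

/-! ## §2 The recursion -/

omit [Fintype σ] in
/-- **From frame data to a forced walk.**  A step relation at every stage and isolation of the top locus for every frame
datum give a `ForcedWalk q Φ₀.s` from any stage-`0` datum. -/
theorem nonempty_forcedWalk [DecidableEq K] (q : ℕ) (Bt : ℕ → Subring L) [∀ i, IsLocalRing (Bt i)] (f : ℕ → L)
    (hstep : ∀ i (Φ : Frame σ K (Bt i) q (f i)), ∃ (j : σ) (b : σ → K) (Φ' : Frame σ K (Bt (i + 1)) q (f (i + 1))),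
      Φ'.s = step q j b Φ.s ∧ b j = 0 ∧ IsEquimultiplePoint q j b Φ.s)
    (hiso : ∀ i (Φ : Frame σ K (Bt i) q (f i)), IsolatedTop q Φ.s.F)
    (Φ₀ : Frame σ K (Bt 0) q (f 0)) : Nonempty (ForcedWalk q Φ₀.s) := by
  let Φ : ∀ i, Frame σ K (Bt i) q (f i) := fun i =>
    Nat.rec (motive := fun i => Frame σ K (Bt i) q (f i)) Φ₀
      (fun i Φi => Classical.choose (Classical.choose_spec (Classical.choose_spec (hstep i Φi)))) i
  have hΦs : ∀ i, Φ (i + 1) = Classical.choose (Classical.choose_spec (Classical.choose_spec (hstep i (Φ i)))) :=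
    fun i => rfl
  have hspec : ∀ i, (Φ (i + 1)).s = step q (Classical.choose (hstep i (Φ i)))
      (Classical.choose (Classical.choose_spec (hstep i (Φ i)))) (Φ i).s ∧
      Classical.choose (Classical.choose_spec (hstep i (Φ i))) (Classical.choose (hstep i (Φ i))) = 0 ∧
      IsEquimultiplePoint q (Classical.choose (hstep i (Φ i))) (Classical.choose (Classical.choose_spec (hstep i (Φ i))))
        (Φ i).s := fun i => by
    rw [hΦs]
    exact Classical.choose_spec (Classical.choose_spec (Classical.choose_spec (hstep i (Φ i))))
  exact ⟨{ j := fun i => Classical.choose (hstep i (Φ i))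
           b := fun i => Classical.choose (Classical.choose_spec (hstep i (Φ i)))
           st := fun i => (Φ i).s
           st_zero := rfl
           st_succ := fun i => (hspec i).1
           onExc := fun i => (hspec i).2.1
           equimult := fun i => (hspec i).2.2
           isolated := fun i => hiso i (Φ i) }⟩

/-- **The frame induction along a chain of certified point blow-ups.**  ℕ-indexed data: subrings `B i ≤ Bt i ≤ Bt (i+1)`
(`Bt i` local), certificates `cert i : PointBlowupCert (B i) (B (i+1)) (M i)`, generation `hgen`, `𝔪_{B_i}·B̃_i = 𝔪_{B̃_i}`
(`hM`), domination of maximal ideals and units, `K`-rational residues, and elements `f i` with `f i = w i · c_{j_i}^q · f (i+1)`,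
`w i` a unit of `Bt (i+1)`, `f (i+1) ∈ 𝔪_{Bt (i+1)}^q`; plus isolation for every frame datum.  Then every stage-`0` frame datum
`Φ₀` starts a forced walk. -/
theorem nonempty_forcedWalk_of_chain (p : ℕ) [Fact p.Prime] [CharP K p] [PerfectField K] [DecidableEq K] (e : ℕ)
    (B Bt : ℕ → Subring L) [∀ i, IsLocalRing (Bt i)] (hB : ∀ i, B i ≤ Bt i) (hBt : ∀ i, Bt i ≤ Bt (i + 1))
    (M : ∀ i, Ideal (B i)) (cert : ∀ i, PointBlowupCert (B i) (B (i + 1)) (M i))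
    (hgen : ∀ i, ∀ w ∈ Bt (i + 1), ∃ x ∈ Subring.closure ((Bt i : Set L) ∪ B (i + 1)),
      ∃ x' ∈ Subring.closure ((Bt i : Set L) ∪ B (i + 1)), x' ∈ unitSet (Bt (i + 1)) ∧ w = x / x')
    (hM : ∀ i (x : L), x ∈ maxSet (Bt i) ↔ ∃ hx : x ∈ Bt i, (⟨x, hx⟩ : Bt i) ∈ (M i).map (Subring.inclusion (hB i)))
    (hmax : ∀ i, maxSet (Bt i) ⊆ maxSet (Bt (i + 1))) (hunit : ∀ i, unitSet (Bt i) ⊆ unitSet (Bt (i + 1)))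
    (hrat : ∀ i, ∀ w ∈ Bt i, ∃ c : K, w - algebraMap K L c ∈ maxSet (Bt i))
    (f w : ℕ → L) (hw : ∀ i, w i ∈ unitSet (Bt (i + 1)))
    (hfact : ∀ i, f i = w i * ((cert i).c (cert i).j : L) ^ p ^ e * f (i + 1))
    (hfq : ∀ i, ∃ h : f (i + 1) ∈ Bt (i + 1), (⟨f (i + 1), h⟩ : Bt (i + 1)) ∈ IsLocalRing.maximalIdeal (Bt (i + 1)) ^ p ^ e)
    (hiso : ∀ i (Φ : Frame σ K (Bt i) (p ^ e) (f i)), IsolatedTop (p ^ e) Φ.s.F)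
    (Φ₀ : Frame σ K (Bt 0) (p ^ e) (f 0)) : Nonempty (ForcedWalk (p ^ e) Φ₀.s) :=
  nonempty_forcedWalk (p ^ e) Bt f
    (fun i Φ => exists_frame_succ p e (hB i) (hBt i) (hB (i + 1)) (cert i) (hgen i) (hM i) (hmax i) (hunit i)
      (hrat (i + 1)) (hw i) (hfact i) (hfq i) Φ)
    hiso Φ₀

/-! ## §3 Stage zero -/

omit [Fintype σ] in
/-- **The stage-`0` frame datum with a ROOT state** (`KRoot.exists_root_frame`, unit `v = 1`): from an injective frame `Θ`
with variables in the local subring `B' ⊇ K` (`K`-rational residues), a subring `C ≤ B'` of which `B'` is a ring of fractions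
with denominators invertible in `B'` and which lies in every subring containing `K` and the quotients `Θ y / Θ z` (`Θ z` a unit),
and `Θ (Z^q + F) ∈ 𝔪_{B'}^q`: a frame datum at `B'` for `f := Θ (Z^q + F)` whose state is a ROOT. -/
theorem exists_root_frame [DecidableEq K] (p : ℕ) [Fact p.Prime] [CharP K p] [PerfectField K] (e : ℕ)
    {B' : Subring L} [IsLocalRing B'] (Θ : MvPolynomial (Option σ) K →ₐ[K] L) (hΘ : Function.Injective Θ)
    (hK : ∀ c : K, algebraMap K L c ∈ B') (hX : ∀ o, Θ (X o) ∈ B')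
    (hrat : ∀ w ∈ B', ∃ c : K, w - algebraMap K L c ∈ maxSet B')
    (C : Subring L) (hC : ∀ R : Subring L, (∀ c : K, algebraMap K L c ∈ R) →
      (∀ y z, Θ z ∈ unitSet B' → Θ y / Θ z ∈ R) → C ≤ R)
    (hfrac : ∀ w ∈ B', ∃ y ∈ C, ∃ z ∈ C, z ≠ 0 ∧ z⁻¹ ∈ B' ∧ w = y / z)
    (F : MvPolynomial σ K)
    (hFq : ∃ hm : Θ (framePoly (p ^ e) F) ∈ B', (⟨Θ (framePoly (p ^ e) F), hm⟩ : B') ∈ IsLocalRing.maximalIdeal B' ^ p ^ e) :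
    ∃ Φ₀ : Frame σ K B' (p ^ e) (Θ (framePoly (p ^ e) F)), IsRoot (p ^ e) Φ₀.s := by
  obtain ⟨θ₀, hθ₀, s₀, hB, hvars, hf, hroot, hs⟩ := KRoot.exists_root_frame p e Θ hΘ hK hX hrat C hC hfrac F hFq
  exact ⟨⟨θ₀, hθ₀, hB, hvars, s₀, hs, 1, one_mem_unitSet, by rw [one_mul]; exact hf⟩, hroot⟩

end

end Summit.ResolutionOfSingularities.ResolutionOfSingularities.Theorems.KFrames
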